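import Literature.Computability.AlgebraicComplexity.BDI20TableauTreewidthDefs
import HarnessLib

/-!
# Bläser–Dörfler–Ikenmeyer 2020/2021, Prop 7.5 (1) holds: treewidth `O(√n)` of two-row
# semistandard tableau graphs — a direct path decomposition (theorem-only file)

Cell `val-lit`, seat x6 (gen 5). DISCHARGES the typed fact `BDI2020_prop_7_5_upper`
(`BDI20HwvEvaluationHardness.lean`; BDI CCC 2021 Prop 7.5 (1) = arXiv:2002.11594 Prop 20 (1):
"Let `S_n` be a semistandard Young tableau with two rows containing the numbers `{1, …, n}`. Then
`G_{S_n}` has treewidth at most `O(√n)`") with the explicit constant `12`: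
`BDI2020_prop_7_5_upper_holds`. All definitions are in the sibling
`BDI20TableauTreewidthDefs.lean` (whose module docstring describes the construction); this file is
theorem-only, sorry-free, no new facts.

HONEST FRAMING / DEVIATION FROM PRINT. The printed proof ("`G_S` is planar [Prop 7.4]; planar
graphs on `n` vertices have treewidth `O(√n)` by the planar excluded grid theorem [RST94]") is NOT
followed: the tree has neither planarity nor the planar separator / excluded-grid theorem. We use
instead the non-crossing observation of the proof of Prop 7.4 — the edge set of `G_S` is a chain
in `ℕ²` (`tableauGraph_chain`) — and give for every such "chain graph" an explicit path
decomposition of width `< 12 (⌊√n⌋ + 1)` (`treewidth_le_of_chain`). Architecture (sections):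
A. any key `V → ℕ` yields a path decomposition (`treewidth_le_of_key`, the vertex-separation
bound [Kinnersley1992]); B. rows of a chain relation (first-head layering: every edge joins row
`i` to row `i+1` or to the first vertex of row `i+2`); C. parents, units, priorities; D. the
process (earliest unit first, deepest ready row first — the greedy layered sweep of
[BannisterEtAl2015, Lemma 3 / Thm 2] adapted to the exceptional edges) and its invariant `Inv`
(`Inv.step`); E. iterating, the key; F.–G. counting: a processed set has at most `12 s - 4`
vertices with an unprocessed neighbour (`card_incomplete_le`: at most four per row of the current
unit, which has `< 2s` rows, plus four narrow boundary rows); H. assembly for graphs on `Fin n`;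
I. two-row semistandard tableaux. `VP ≠ VNP` is NOT proved and nothing here bears on it beyond
making a typed literature fact a theorem of the tree.

## References
* [BlaserDorflerIkenmeyer2020] arXiv:2002.11594 Props 19, 20 (1) (= CCC 2021 LIPIcs 200:29 Props
  7.4, 7.5 (1)); held text `paper:arxiv-2002.11594` p0015.txt:L91 – p0016.txt:L30.
* [BannisterEtAl2015] Bannister–Devanny–Dujmović–Eppstein–Wood, *Track layouts, layered path
  decompositions, and leveled planarity*, Algorithmica 81 (2019), arXiv:1506.09145, Lemma 3, Thm 2
  (held text `paper:arxiv-1506.09145` p0006.txt:L9-29).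
* [Kinnersley1992] N. G. Kinnersley, *The vertex separation number of a graph equals its
  path-width*, Inf. Process. Lett. 42 (1992) 345–350.
-/

noncomputable section

open scoped Classical

namespace Literature.Computability.AlgebraicComplexity

namespace BDI20Treewidth

open Literature.Combinatorics.SimpleGraph _root_.SimpleGraph

/-! ### A. Path decompositions from an arbitrary key function -/

/-- Membership in a key bag. [folklore] -/
private theorem mem_keyBag {V : Type*} [Fintype V] {G : _root_.SimpleGraph V} {key : V → ℕ} {t : ℕ}
    {v : V} : v ∈ keyBag G key t ↔ key v = t ∨ (key v < t ∧ ∃ u, G.Adj v u ∧ t ≤ key u) := by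
  simp [keyBag]

/-- **Path decompositions from a key.** For ANY `key : V → ℕ` bounded by `K`, the bags
`keyBag G key t` (`t ≤ K`) form a path decomposition of `G`; hence if every bag has at most `w + 1`
vertices then `treewidth G ≤ w`. This is the easy direction of "vertex separation number =
pathwidth" for the linear layout `key` (ties allowed).
[cite: Kinnersley1992, Thm 3.1 (vs(G) ≥ pw(G) direction; layout ↦ path decomposition)] -/
theorem treewidth_le_of_key {V : Type*} [Fintype V] (G : _root_.SimpleGraph V) (key : V → ℕ)
    (K w : ℕ) (hK : ∀ v, key v ≤ K) (hcard : ∀ t ≤ K, (keyBag G key t).card ≤ w + 1) :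
    treewidth G ≤ w := by
  refine treewidth_le_of_intervals G (fun t : Fin (K + 1) => keyBag G key t) ?_ ?_ ?_
    (fun t => hcard t (Nat.le_of_lt_succ t.isLt))
  · intro u v huv
    rcases le_total (key u) (key v) with h | h
    · refine ⟨⟨key v, Nat.lt_succ_of_le (hK v)⟩, ?_, ?_⟩
      · rcases h.lt_or_eq with h' | h'
        · exact mem_keyBag.2 (Or.inr ⟨h', v, huv, le_rfl⟩)
        · exact mem_keyBag.2 (Or.inl h')
      · exact mem_keyBag.2 (Or.inl rfl)
    · refine ⟨⟨key u, Nat.lt_succ_of_le (hK u)⟩, ?_, ?_⟩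
      · exact mem_keyBag.2 (Or.inl rfl)
      · rcases h.lt_or_eq with h' | h'
        · exact mem_keyBag.2 (Or.inr ⟨h', u, huv.symm, le_rfl⟩)
        · exact mem_keyBag.2 (Or.inl h')
  · intro v
    exact ⟨⟨key v, Nat.lt_succ_of_le (hK v)⟩, mem_keyBag.2 (Or.inl rfl)⟩
  · intro v
    refine Set.ordConnected_iff.2 fun t₁ ht₁ t₂ ht₂ _ t ⟨h1, h2⟩ => ?_
    have h1' : (t₁ : ℕ) ≤ t := h1
    have h2' : (t : ℕ) ≤ t₂ := h2
    rcases mem_keyBag.1 ht₁ with e₁ | ⟨l₁, -⟩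
    · rcases (e₁ ▸ h1' : key v ≤ t).lt_or_eq with hlt | heq
      · rcases mem_keyBag.1 ht₂ with e₂ | ⟨-, u, hu, hu'⟩
        · exact absurd e₂ (by omega)
        · exact mem_keyBag.2 (Or.inr ⟨hlt, u, hu, h2'.trans hu'⟩)
      · exact mem_keyBag.2 (Or.inl heq)
    · have hlt : key v < t := lt_of_lt_of_le l₁ h1'
      rcases mem_keyBag.1 ht₂ with e₂ | ⟨-, u, hu, hu'⟩
      · exact absurd e₂ (by omega)
      · exact mem_keyBag.2 (Or.inr ⟨hlt, u, hu, h2'.trans hu'⟩)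

/-! ### B. Chain relations on `ℕ` and their row structure -/

namespace IsChainRel

variable {n : ℕ} {E : ℕ → ℕ → Prop} (H : IsChainRel n E)
include H

/-- In a chain relation the edge with the smaller head has the smaller-or-equal tail. [folklore] -/
private theorem tail_le {a b a' b' : ℕ} (hab : E a b) (hab' : E a' b') (h : b < b') : a ≤ a' := by
  by_contra hc
  exact absurd (H.chain hab' hab (lt_of_not_ge hc)) (not_le.2 h)

end IsChainRel

section Rows

variable {n : ℕ} {E : ℕ → ℕ → Prop} (H : IsChainRel n E)
include H

omit H in
/-- The first row starts at `0`. [folklore] -/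
private theorem xr_zero : xr n E 0 = 0 := rfl

/-- Row starts are at most `n`. [folklore] -/
private theorem xr_succ_le : ∀ i, xr n E (i + 1) ≤ n := by
  intro i
  show (if h : ∃ b a, xr n E i ≤ a ∧ E a b then Nat.find h else n) ≤ n
  split_ifs with h
  · obtain ⟨a, -, hab⟩ := Nat.find_spec h
    exact (H.bound hab).le
  · exact le_rfl

/-- Row starts are at most `n`. [folklore] -/
private theorem xr_le (i : ℕ) : xr n E i ≤ n := by
  cases i with
  | zero => exact Nat.zero_le _
  | succ i => exact xr_succ_le H i

/-- Row starts increase strictly while below `n`. [folklore] -/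
private theorem xr_lt_succ_of_lt {i : ℕ} (hi : xr n E i < n) : xr n E i < xr n E (i + 1) := by
  show xr n E i < (if h : ∃ b a, xr n E i ≤ a ∧ E a b then Nat.find h else n)
  split_ifs with h
  · obtain ⟨a, ha, hab⟩ := Nat.find_spec h
    exact lt_of_le_of_lt ha (H.lt hab)
  · exact hi

/-- Once a row start reaches `n`, all later ones are `n`. [folklore] -/
private theorem xr_succ_eq_of_eq {i : ℕ} (hi : xr n E i = n) : xr n E (i + 1) = n := by
  show (if h : ∃ b a, xr n E i ≤ a ∧ E a b then Nat.find h else n) = n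
  split_ifs with h
  · obtain ⟨b, a, ha, hab⟩ := h
    have := H.lt hab
    have := H.bound hab
    omega
  · rfl

/-- Row starts are weakly increasing. [folklore] -/
private theorem xr_le_succ (i : ℕ) : xr n E i ≤ xr n E (i + 1) := by
  rcases (xr_le H i).lt_or_eq with h | h
  · exact (xr_lt_succ_of_lt H h).le
  · rw [xr_succ_eq_of_eq H h, h]

/-- Row starts are monotone. [folklore] -/
private theorem xr_mono : Monotone (xr n E) :=
  monotone_nat_of_le_succ (xr_le_succ H)

/-- `min i n ≤ xr i`. [folklore] -/
private theorem le_xr (i : ℕ) : min i n ≤ xr n E i := by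
  induction i with
  | zero => simp [xr_zero]
  | succ i ih =>
    rcases (xr_le H i).lt_or_eq with h | h
    · have := xr_lt_succ_of_lt H h
      omega
    · rw [xr_succ_eq_of_eq H h]
      exact min_le_right _ _

/-- `xr n = n`: there are at most `n` nonempty rows. [folklore] -/
private theorem xr_n : xr n E n = n :=
  le_antisymm (xr_le H n) (by simpa using le_xr H n)

/-- The defining inequalities of the row of a vertex. [folklore] -/
private theorem row_spec {v : ℕ} (hv : v < n) : xr n E (row n E v) ≤ v ∧ v < xr n E (row n E v + 1) := by
  have hex : ∃ i, v < xr n E (i + 1) := ⟨n, lt_of_lt_of_le hv (by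
    have := xr_mono H (Nat.le_succ n); rw [xr_n H] at this; exact this)⟩
  have hrow : row n E v = Nat.find hex := by simp [row, hex]
  refine ⟨?_, by rw [hrow]; exact Nat.find_spec hex⟩
  rw [hrow]
  rcases Nat.eq_zero_or_pos (Nat.find hex) with h0 | hpos
  · rw [h0]; exact Nat.zero_le _
  · obtain ⟨k, hk⟩ : ∃ k, Nat.find hex = k + 1 := ⟨Nat.find hex - 1, by omega⟩
    have hmin := Nat.find_min hex (show k < Nat.find hex by omega)
    rw [hk]
    exact not_lt.1 hmin

/-- Characterisation of the row: `row v = i` iff `xr i ≤ v < xr (i+1)`. [folklore] -/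
private theorem row_eq_iff {v i : ℕ} (hv : v < n) : row n E v = i ↔ xr n E i ≤ v ∧ v < xr n E (i + 1) := by
  constructor
  · rintro rfl; exact row_spec H hv
  · rintro ⟨h1, h2⟩
    obtain ⟨h3, h4⟩ := row_spec H hv
    by_contra hne
    rcases lt_or_gt_of_ne hne with hlt | hgt
    · have := xr_mono H (show row n E v + 1 ≤ i from hlt)
      omega
    · have := xr_mono H (show i + 1 ≤ row n E v from hgt)
      omega

/-- The row of a row start. [folklore] -/
private theorem row_xr {i : ℕ} (hi : xr n E i < n) : row n E (xr n E i) = i :=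
  (row_eq_iff H hi).2 ⟨le_rfl, xr_lt_succ_of_lt H hi⟩

/-- The row is monotone in the vertex. [folklore] -/
private theorem row_mono {u v : ℕ} (huv : u ≤ v) (hv : v < n) : row n E u ≤ row n E v := by
  by_contra h
  have h' : row n E v + 1 ≤ row n E u := by omega
  have h1 := (row_spec H (lt_of_le_of_lt huv hv)).1
  have h2 := (row_spec H hv).2
  have := xr_mono H h'
  omega

/-- Rows of vertices are `< n`. [folklore] -/
private theorem row_lt_n {v : ℕ} (hv : v < n) : row n E v < n := by
  by_contra h
  have h' : n ≤ row n E v := not_lt.1 h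
  have h1 := (row_spec H hv).1
  have := xr_mono H h'
  rw [xr_n H] at this
  omega

/-- Layering, lower bound: a head lies at or after the start of the row after its tail's row. [folklore] -/
private theorem xr_succ_le_head {a b : ℕ} (hab : E a b) : xr n E (row n E a + 1) ≤ b := by
  have ha : a < n := lt_trans (H.lt hab) (H.bound hab)
  have h1 := (row_spec H ha).1
  have hex : ∃ b' a', xr n E (row n E a) ≤ a' ∧ E a' b' := ⟨b, a, h1, hab⟩
  show (if h : ∃ b' a', xr n E (row n E a) ≤ a' ∧ E a' b' then Nat.find h else n) ≤ b
  rw [dif_pos hex]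
  exact Nat.find_le ⟨a, h1, hab⟩

/-- Layering, upper bound: a head lies at or before the start of the row two after its tail's row. [folklore] -/
private theorem head_le_xr_add_two {a b : ℕ} (hab : E a b) : b ≤ xr n E (row n E a + 2) := by
  have ha : a < n := lt_trans (H.lt hab) (H.bound hab)
  have h2 := (row_spec H ha).2
  show b ≤ (if h : ∃ b' a', xr n E (row n E a + 1) ≤ a' ∧ E a' b' then Nat.find h else n)
  split_ifs with h
  · obtain ⟨a', ha', hab'⟩ := Nat.find_spec h
    exact H.chain hab hab' (lt_of_lt_of_le h2 ha')
  · exact (H.bound hab).le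

/-- Layering: a head is in the next row, or it is the first vertex of the row after next (an exceptional edge). [folklore] -/
private theorem row_head {a b : ℕ} (hab : E a b) :
    row n E b = row n E a + 1 ∨ (b = xr n E (row n E a + 2) ∧ row n E b = row n E a + 2) := by
  have hb : b < n := H.bound hab
  have h1 := xr_succ_le_head H hab
  rcases (head_le_xr_add_two H hab).lt_or_eq with h2 | h2
  · exact Or.inl ((row_eq_iff H hb).2 ⟨h1, h2⟩)
  · refine Or.inr ⟨h2, ?_⟩
    have := row_xr H (show xr n E (row n E a + 2) < n from h2 ▸ hb)
    rwa [← h2] at this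

/-- A head is at least one row below its tail. [folklore] -/
private theorem row_head_ge {a b : ℕ} (hab : E a b) : row n E a + 1 ≤ row n E b := by
  rcases row_head H hab with h | ⟨-, h⟩ <;> omega

/-- A head is at most two rows below its tail. [folklore] -/
private theorem row_head_le {a b : ℕ} (hab : E a b) : row n E b ≤ row n E a + 2 := by
  rcases row_head H hab with h | ⟨-, h⟩ <;> omega

/-- The first vertex of every row after row `0` has a tail in the previous row. [folklore] -/
private theorem exists_tail_xr_succ {i : ℕ} (hi : xr n E (i + 1) < n) :
    ∃ a, E a (xr n E (i + 1)) ∧ row n E a = i := by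
  have hex : ∃ b a, xr n E i ≤ a ∧ E a b := by
    by_contra h
    have : xr n E (i + 1) = n := by
      show (if h : ∃ b a, xr n E i ≤ a ∧ E a b then Nat.find h else n) = n
      rw [dif_neg h]
    omega
  have hx : xr n E (i + 1) = Nat.find hex := by
    show (if h : ∃ b a, xr n E i ≤ a ∧ E a b then Nat.find h else n) = _
    rw [dif_pos hex]
  obtain ⟨a, ha, hab⟩ := Nat.find_spec hex
  rw [← hx] at hab
  refine ⟨a, hab, (row_eq_iff H (lt_trans (H.lt hab) hi)).2 ⟨ha, H.lt hab⟩⟩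

end Rows

/-! ### C. Parents, units, priorities -/

section Basic

variable {n : ℕ} {E : ℕ → ℕ → Prop} (H : IsChainRel n E)
include H

omit H in
/-- Membership in a row set. [folklore] -/
private theorem mem_rowSet {i v : ℕ} : v ∈ rowSet n E i ↔ xr n E i ≤ v ∧ v < xr n E (i + 1) := by
  simp [rowSet]

/-- Members of a row set are `< n`. [folklore] -/
private theorem lt_n_of_mem_rowSet {i v : ℕ} (h : v ∈ rowSet n E i) : v < n :=
  lt_of_lt_of_le ((mem_rowSet).1 h).2 (xr_succ_le H i)

/-- A vertex lies in the row set of `i` iff its row is `i`. [folklore] -/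
private theorem mem_rowSet_iff_row {i v : ℕ} (hv : v < n) : v ∈ rowSet n E i ↔ row n E v = i := by
  rw [mem_rowSet, row_eq_iff H hv]

/-- A vertex lies in the row set of its row. [folklore] -/
private theorem mem_rowSet_row {v : ℕ} (hv : v < n) : v ∈ rowSet n E (row n E v) :=
  (mem_rowSet_iff_row H hv).2 rfl

omit H in
/-- The size of a row. [folklore] -/
private theorem card_rowSet (i : ℕ) : (rowSet n E i).card = xr n E (i + 1) - xr n E i := by
  simp [rowSet]

omit H in
/-- Membership in the previous-row tails. [folklore] -/
private theorem mem_prevTails {v a : ℕ} :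
    a ∈ prevTails n E v ↔ a < n ∧ E a v ∧ row n E a + 1 = row n E v := by
  simp [prevTails]

/-- A tail one row up is a previous-row tail. [folklore] -/
private theorem mem_prevTails_of {v a : ℕ} (hav : E a v) (hr : row n E a + 1 = row n E v) :
    a ∈ prevTails n E v :=
  (mem_prevTails).2 ⟨lt_trans (H.lt hav) (H.bound hav), hav, hr⟩

omit H in
/-- The parent of a vertex with previous-row tails is the least of them. [folklore] -/
private theorem par_of_nonempty {v : ℕ} (h : (prevTails n E v).Nonempty) :
    par n E v ∈ prevTails n E v ∧ ∀ a ∈ prevTails n E v, par n E v ≤ a := by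
  have : par n E v = (prevTails n E v).min' h := by simp [par, h]
  rw [this]
  exact ⟨Finset.min'_mem _ _, fun a ha => Finset.min'_le _ _ ha⟩

omit H in
/-- The parent of a vertex without previous-row tails is its predecessor. [folklore] -/
private theorem par_of_empty {v : ℕ} (h : ¬ (prevTails n E v).Nonempty) : par n E v = v - 1 := by
  simp [par, h]

omit H in
/-- Vertices of row `0` have no previous-row tails. [folklore] -/
private theorem prevTails_eq_empty_of_row_zero {v : ℕ} (hv : row n E v = 0) :
    ¬ (prevTails n E v).Nonempty := by
  rintro ⟨a, ha⟩
  have := ((mem_prevTails).1 ha).2.2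
  omega

/-- The first vertex of a later row has a previous-row tail. [folklore] -/
private theorem prevTails_xr_nonempty {i : ℕ} (hi : xr n E (i + 1) < n) :
    (prevTails n E (xr n E (i + 1))).Nonempty := by
  obtain ⟨a, ha, hra⟩ := exists_tail_xr_succ H hi
  exact ⟨a, mem_prevTails_of H ha (by rw [hra, row_xr H hi])⟩

/-- A vertex other than `0` without previous-row tails is not the first of its row: its predecessor lies in the same row. [folklore] -/
private theorem row_pred_of_empty {v : ℕ} (hv : v < n) (hv0 : v ≠ 0)
    (h : ¬ (prevTails n E v).Nonempty) : row n E (v - 1) = row n E v ∧ v - 1 < v := by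
  refine ⟨?_, by omega⟩
  have hs := row_spec H hv
  have hne : v ≠ xr n E (row n E v) := by
    intro heq
    rcases Nat.eq_zero_or_pos (row n E v) with h0 | hpos
    · rw [h0, xr_zero] at heq; exact hv0 heq
    · obtain ⟨k, hk⟩ : ∃ k, row n E v = k + 1 := ⟨row n E v - 1, by omega⟩
      rw [hk] at heq
      have := prevTails_xr_nonempty H (show xr n E (k + 1) < n from heq ▸ hv)
      rw [← heq] at this
      exact h this
  exact (row_eq_iff H (by omega)).2 ⟨by omega, by omega⟩

/-- The parent of a nonzero vertex is smaller. [folklore] -/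
private theorem par_lt {v : ℕ} (hv0 : v ≠ 0) : par n E v < v := by
  by_cases h : (prevTails n E v).Nonempty
  · have := ((mem_prevTails).1 (par_of_nonempty h).1).2.1
    exact H.lt this
  · rw [par_of_empty h]; omega

/-- Parents are `< n`. [folklore] -/
private theorem par_lt_n {v : ℕ} (hv : v < n) : par n E v < n := by
  by_cases h0 : v = 0
  · subst h0
    by_cases h : (prevTails n E 0).Nonempty
    · exact ((mem_prevTails).1 (par_of_nonempty h).1).1
    · rw [par_of_empty h]; exact hv
  · exact lt_trans (par_lt H h0) hv

/-- Chain monotonicity of previous-row tails: a tail of a smaller head is at most any tail of a larger head. [folklore] -/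
private theorem prevTails_mono {v v' a a' : ℕ} (hvv : v < v') (ha : a ∈ prevTails n E v)
    (ha' : a' ∈ prevTails n E v') : a ≤ a' :=
  H.tail_le ((mem_prevTails).1 ha).2.1 ((mem_prevTails).1 ha').2.1 hvv

/-! Units. -/

omit H in
/-- The unit index steps by one exactly at unit ends. [folklore] -/
private theorem unitOf_succ (i : ℕ) :
    unitOf n E (i + 1) = unitOf n E i + (if IsEnd n E i then 1 else 0) := by
  simp only [unitOf, Finset.range_add_one, Finset.filter_insert]
  split_ifs with h
  · rw [Finset.card_insert_of_notMem (by simp)]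
  · rfl

omit H in
/-- The unit index is monotone. [folklore] -/
private theorem unitOf_mono : Monotone (unitOf n E) :=
  monotone_nat_of_le_succ fun i => by
    show unitOf n E i ≤ unitOf n E (i + 1)
    rw [unitOf_succ]; omega

omit H in
/-- Consecutive rows share a unit iff the first is not a unit end. [folklore] -/
private theorem unitOf_succ_eq_iff (i : ℕ) : unitOf n E (i + 1) = unitOf n E i ↔ ¬ IsEnd n E i := by
  rw [unitOf_succ]; split_ifs with h <;> simp [h]

omit H in
/-- If rows `i` and `i+2` share a unit, neither `i` nor `i+1` is a unit end. [folklore] -/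
private theorem not_isEnd_of_unitOf_add_two {i : ℕ} (h : unitOf n E (i + 2) = unitOf n E i) :
    ¬ IsEnd n E i ∧ ¬ IsEnd n E (i + 1) := by
  have h1 := unitOf_succ (n := n) (E := E) i
  have h2 := unitOf_succ (n := n) (E := E) (i + 1)
  have h' : unitOf n E (i + 1 + 1) = unitOf n E i := h
  constructor
  · intro he; rw [if_pos he] at h1; split_ifs at h2 <;> omega
  · intro he; rw [if_pos he] at h2; split_ifs at h1 <;> omega

omit H in
/-- If rows `i` and `i+2` share a unit, so do `i` and `i+1`. [folklore] -/
private theorem unitOf_add_one_eq_of_add_two {i : ℕ} (h : unitOf n E (i + 2) = unitOf n E i) :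
    unitOf n E (i + 1) = unitOf n E i := by
  have h1 := unitOf_mono (n := n) (E := E) (show i ≤ i + 1 by omega)
  have h2 := unitOf_mono (n := n) (E := E) (show i + 1 ≤ i + 1 + 1 by omega)
  have h' : unitOf n E (i + 1 + 1) = unitOf n E i := h
  omega

omit H in
/-- A row followed within two rows by a row of another unit is narrow. [folklore] -/
private theorem not_wide_of_unitOf_ne {i : ℕ} (h : unitOf n E (i + 2) ≠ unitOf n E i) : ¬ Wide n E i := by
  by_contra hw
  have h1 : ¬ IsEnd n E i := fun he => he.1 hw
  have h2 : ¬ IsEnd n E (i + 1) := fun he => by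
    rcases he.2 with h0 | h0
    · omega
    · exact h0 (by simpa using hw)
  rw [← unitOf_succ_eq_iff] at h1 h2
  exact h (by rw [show i + 2 = i + 1 + 1 from rfl, h2, h1])

omit H in
/-- Comparison of priorities: earlier unit, or same unit and deeper. [folklore] -/
private theorem prio_le_iff {i i' : ℕ} (hi : i ≤ n) (hi' : i' ≤ n) :
    prio n E i ≤ prio n E i' ↔
      unitOf n E i < unitOf n E i' ∨ (unitOf n E i = unitOf n E i' ∧ i' ≤ i) := by
  unfold prio
  constructor
  · intro h
    rcases lt_trichotomy (unitOf n E i) (unitOf n E i') with hlt | heq | hgt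
    · exact Or.inl hlt
    · right; refine ⟨heq, ?_⟩; rw [heq] at h; omega
    · exfalso
      have : unitOf n E i' * (n + 1) + (n + 1) ≤ unitOf n E i * (n + 1) := by
        have := Nat.mul_le_mul_right (n + 1) hgt
        rw [Nat.succ_mul] at this; exact this
      omega
  · rintro (hlt | ⟨heq, hle⟩)
    · have : unitOf n E i * (n + 1) + (n + 1) ≤ unitOf n E i' * (n + 1) := by
        have := Nat.mul_le_mul_right (n + 1) hlt
        rw [Nat.succ_mul] at this; exact this
      omega
    · rw [heq]; omega

omit H in
/-- A deeper row of the same unit has strictly smaller priority value. [folklore] -/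
private theorem prio_lt_of_deeper {i i' : ℕ} (hi' : i' ≤ n) (hlt : i < i')
    (hu : unitOf n E i' = unitOf n E i) : prio n E i' < prio n E i := by
  unfold prio; rw [hu]; omega

end Basic

/-! ### D. The process: invariants -/

section Process

variable {n : ℕ} {E : ℕ → ℕ → Prop} (H : IsChainRel n E)
include H

omit H in
/-- Membership in the unprocessed part of a row. [folklore] -/
private theorem mem_missing {P : Finset ℕ} {i v : ℕ} :
    v ∈ missing n E P i ↔ v ∈ rowSet n E i ∧ v ∉ P := by
  simp [missing]

omit H in
/-- The least unprocessed vertex of a row is unprocessed and least. [folklore] -/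
private theorem nextV_spec {P : Finset ℕ} {i : ℕ} (h : (missing n E P i).Nonempty) :
    nextV n E P i ∈ missing n E P i ∧ ∀ v ∈ missing n E P i, nextV n E P i ≤ v := by
  have : nextV n E P i = (missing n E P i).min' h := by simp [nextV, h]
  rw [this]
  exact ⟨Finset.min'_mem _ _, fun v hv => Finset.min'_le _ _ hv⟩

omit H in
/-- Membership in the set of ready rows. [folklore] -/
private theorem mem_readyRows {P : Finset ℕ} {i : ℕ} :
    i ∈ readyRows n E P ↔ i < n + 1 ∧ (missing n E P i).Nonempty ∧ Ready n E P (nextV n E P i) := by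
  simp [readyRows]

omit H in
/-- A step processes the least unprocessed vertex of the selected row. [folklore] -/
private theorem step_of_nonempty {P : Finset ℕ} (h : (readyRows n E P).Nonempty) :
    step n E P = insert (nextV n E P (sel n E P h)) P := by
  simp [step, h]

omit H in
/-- With no ready row a step changes nothing. [folklore] -/
private theorem step_of_empty {P : Finset ℕ} (h : ¬ (readyRows n E P).Nonempty) : step n E P = P := by
  simp [step, h]

omit H in
/-- The selected row is ready and of least priority value. [folklore] -/
private theorem sel_spec (P : Finset ℕ) (h : (readyRows n E P).Nonempty) :
    sel n E P h ∈ readyRows n E P ∧ ∀ i' ∈ readyRows n E P, prio n E (sel n E P h) ≤ prio n E i' :=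
  Classical.choose_spec (Finset.exists_min_image (readyRows n E P) (prio n E) h)

omit H in
/-- Steps only add vertices. [folklore] -/
private theorem subset_step (P : Finset ℕ) : P ⊆ step n E P := by
  by_cases h : (readyRows n E P).Nonempty
  · rw [step_of_nonempty h]; exact Finset.subset_insert _ _
  · rw [step_of_empty h]

omit H in
/-- The empty processed set satisfies the invariant. [folklore] -/
private theorem Inv.empty : Inv n E ∅ where
  sub := by simp
  prefix_ := by simp
  closed := by simp
  seq := by simp
  j1 := by simp
  j2 := by simp

/-- Under the prefix invariant the processed vertices of a row are exactly those below its least unprocessed vertex. [folklore] -/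
private theorem Inv.mem_iff_lt_nextV {P : Finset ℕ} (hP : Inv n E P) {i u : ℕ}
    (h : (missing n E P i).Nonempty) (hu : u ∈ rowSet n E i) : u ∈ P ↔ u < nextV n E P i := by
  obtain ⟨hN, hmin⟩ := nextV_spec h
  obtain ⟨hNrow, hNP⟩ := (mem_missing).1 hN
  constructor
  · intro huP
    by_contra hc
    rcases (not_lt.1 hc).lt_or_eq with hlt | heq
    · refine hNP (hP.prefix_ huP hlt ?_)
      rw [(mem_rowSet_iff_row H (lt_n_of_mem_rowSet H hNrow)).1 hNrow,
        (mem_rowSet_iff_row H (lt_n_of_mem_rowSet H hu)).1 hu]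
    · exact hNP (heq ▸ huP)
  · intro hlt
    by_contra hc
    exact absurd (hmin u ((mem_missing).2 ⟨hu, hc⟩)) (not_le.2 hlt)

omit H in
/-- A row with no unprocessed vertex is fully processed. [folklore] -/
private theorem subset_of_missing_empty {P : Finset ℕ} {i : ℕ}
    (h : ¬ (missing n E P i).Nonempty) : rowSet n E i ⊆ P := by
  intro u hu
  by_contra hc
  exact h ⟨u, (mem_missing).2 ⟨hu, hc⟩⟩

/-- The row of the least unprocessed vertex is ready, and that vertex is its least unprocessed vertex. [folklore] -/
private theorem row_min_mem_readyRows {P : Finset ℕ}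
    (hne : ((Finset.range n) \ P).Nonempty) :
    row n E (((Finset.range n) \ P).min' hne) ∈ readyRows n E P ∧
      nextV n E P (row n E (((Finset.range n) \ P).min' hne)) = ((Finset.range n) \ P).min' hne := by
  set m := ((Finset.range n) \ P).min' hne with hm
  have hmmem : m ∈ (Finset.range n) \ P := Finset.min'_mem _ _
  have hmn : m < n := by simpa using (Finset.mem_sdiff.1 hmmem).1
  have hmP : m ∉ P := (Finset.mem_sdiff.1 hmmem).2
  have hmle : ∀ w, w < n → w ∉ P → m ≤ w := fun w hw hwP =>
    Finset.min'_le _ _ (Finset.mem_sdiff.2 ⟨by simpa using hw, hwP⟩)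
  have hmiss : (missing n E P (row n E m)).Nonempty :=
    ⟨m, (mem_missing).2 ⟨mem_rowSet_row H hmn, hmP⟩⟩
  have hnext : nextV n E P (row n E m) = m := by
    obtain ⟨hN, hmin⟩ := nextV_spec hmiss
    obtain ⟨hNrow, hNP⟩ := (mem_missing).1 hN
    exact le_antisymm (hmin m ((mem_missing).2 ⟨mem_rowSet_row H hmn, hmP⟩))
      (hmle _ (lt_n_of_mem_rowSet H hNrow) hNP)
  refine ⟨(mem_readyRows).2 ⟨Nat.lt_succ_of_lt (row_lt_n H hmn), hmiss, ?_⟩, hnext⟩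
  rw [hnext]
  by_cases h0 : m = 0
  · exact Or.inl h0
  · right
    by_contra hc
    exact absurd (hmle _ (par_lt_n H hmn) hc) (not_le.2 (par_lt H h0))

/-- Progress: while some vertex is unprocessed, some row is ready. [folklore] -/
private theorem readyRows_nonempty {P : Finset ℕ}
    (hne : ((Finset.range n) \ P).Nonempty) : (readyRows n E P).Nonempty :=
  ⟨_, (row_min_mem_readyRows H hne).1⟩

/-- Data of a step: the selected row `i₀ ≤ n` and the processed vertex `z`, least unprocessed in row `i₀`, ready, with all smaller vertices of its row processed, and `i₀` of least priority value among ready rows. [folklore] -/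
private theorem Inv.step_data {P : Finset ℕ} (hP : Inv n E P) (h : (readyRows n E P).Nonempty) :
    let i₀ := sel n E P h
    let z := nextV n E P i₀
    i₀ ≤ n ∧ (missing n E P i₀).Nonempty ∧ z ∈ rowSet n E i₀ ∧ z ∉ P ∧ z < n ∧ row n E z = i₀ ∧
      Ready n E P z ∧ (∀ u ∈ rowSet n E i₀, u < z → u ∈ P) ∧
      (∀ i' ∈ readyRows n E P, prio n E i₀ ≤ prio n E i') := by
  intro i₀ z
  obtain ⟨hsel, hmin⟩ := sel_spec P h
  obtain ⟨hi₀, hmiss, hready⟩ := (mem_readyRows).1 hsel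
  obtain ⟨hz, -⟩ := nextV_spec hmiss
  obtain ⟨hzrow, hzP⟩ := (mem_missing).1 hz
  have hzn := lt_n_of_mem_rowSet H hzrow
  refine ⟨Nat.le_of_lt_succ hi₀, hmiss, hzrow, hzP, hzn, (mem_rowSet_iff_row H hzn).1 hzrow, hready,
    fun u hu hlt => (hP.mem_iff_lt_nextV H hmiss hu).2 hlt, hmin⟩

/-- A deeper row of the selected row's unit is not ready. [folklore] -/
private theorem Inv.not_ready_deeper {P : Finset ℕ} (hP : Inv n E P) (h : (readyRows n E P).Nonempty)
    {i' : ℕ} (hlt : sel n E P h < i') (hi' : i' ≤ n)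
    (hu : unitOf n E i' = unitOf n E (sel n E P h)) (hmiss : (missing n E P i').Nonempty) :
    ¬ Ready n E P (nextV n E P i') := by
  intro hr
  have hmem : i' ∈ readyRows n E P := (mem_readyRows).2 ⟨Nat.lt_succ_of_le hi', hmiss, hr⟩
  have h1 := (hP.step_data H h).2.2.2.2.2.2.2.2 i' hmem
  have h2 := prio_lt_of_deeper (n := n) (E := E) hi' hlt hu
  omega

/-- If the least unprocessed vertex of a row is not ready, its parent is an unprocessed previous-row tail of it. [folklore] -/
private theorem Inv.par_of_not_ready {P : Finset ℕ} (hP : Inv n E P) {i' : ℕ}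
    (hmiss : (missing n E P i').Nonempty) (hnr : ¬ Ready n E P (nextV n E P i')) :
    (prevTails n E (nextV n E P i')).Nonempty ∧ par n E (nextV n E P i') ∉ P ∧
      par n E (nextV n E P i') ∈ prevTails n E (nextV n E P i') := by
  set N := nextV n E P i' with hN
  have h0 : N ≠ 0 := fun h => hnr (Or.inl h)
  have hparP : par n E N ∉ P := fun h => hnr (Or.inr h)
  obtain ⟨hNm, -⟩ := nextV_spec hmiss
  obtain ⟨hNrow, hNP⟩ := (mem_missing).1 hNm
  have hNn := lt_n_of_mem_rowSet H hNrow
  have hrowN : row n E N = i' := (mem_rowSet_iff_row H hNn).1 hNrow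
  have hne : (prevTails n E N).Nonempty := by
    by_contra hc
    have hpar : par n E N = N - 1 := par_of_empty hc
    obtain ⟨hr, hlt⟩ := row_pred_of_empty H hNn h0 hc
    have hmem : N - 1 ∈ rowSet n E i' := (mem_rowSet_iff_row H (by omega)).2 (hr.trans hrowN)
    have : N - 1 ∈ P := (hP.mem_iff_lt_nextV H hmiss hmem).2 hlt
    exact hparP (hpar ▸ this)
  exact ⟨hne, hparP, (par_of_nonempty hne).1⟩

omit H in
/-- Processing a vertex does not decrease the least unprocessed vertex of a row. [folklore] -/
private theorem nextV_mono {P : Finset ℕ} {z i : ℕ} (h : (missing n E (insert z P) i).Nonempty) :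
    nextV n E P i ≤ nextV n E (insert z P) i := by
  have hsub : missing n E (insert z P) i ⊆ missing n E P i := by
    intro v hv
    obtain ⟨hv1, hv2⟩ := (mem_missing).1 hv
    exact (mem_missing).2 ⟨hv1, fun hc => hv2 (Finset.mem_insert_of_mem hc)⟩
  have h' : (missing n E P i).Nonempty := h.mono hsub
  exact (nextV_spec h').2 _ (hsub (nextV_spec h).1)

omit H in
/-- Readiness is monotone in the processed set. [folklore] -/
private theorem Ready.mono {P Q : Finset ℕ} (hPQ : P ⊆ Q) {v : ℕ} (h : Ready n E P v) : Ready n E Q v := by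
  rcases h with h | h
  · exact Or.inl h
  · exact Or.inr (hPQ h)

/-- **The invariant is preserved by a step.** The heart of the argument: the new vertex `z` of row `i₀` keeps `j1` because the least unprocessed vertex of row `i₀+1` (same unit, hence not ready) must have parent `z`, and keeps `j2` because a second tail of an unprocessed exceptional head `xr (i₀+2)` would force, through the non-ready rows `i₀+1`, `i₀+2`, two crossing edges. [folklore] -/
private theorem Inv.step {P : Finset ℕ} (hP : Inv n E P) : Inv n E (step n E P) := by
  by_cases h : (readyRows n E P).Nonempty
  swap
  · rw [step_of_empty h]; exact hP
  rw [step_of_nonempty h]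
  obtain ⟨hi₀n, hmiss, hzrow, hzP, hzn, hrowz, hready, hbelow, hmin⟩ := hP.step_data H h
  set i₀ := sel n E P h with hi₀def
  set z := nextV n E P i₀ with hzdef
  have hPP' : P ⊆ insert z P := Finset.subset_insert _ _
  -- the key sub-argument, used twice: the least unprocessed vertex `N` of row `i₀ + 1`, when
  -- that row is in the unit of `i₀`, has parent `z`, provided `z` has a head `b ≥ N` in that row
  have hkey : ∀ {b : ℕ}, E z b → row n E b = i₀ + 1 → b ∉ P →
      unitOf n E (i₀ + 1) = unitOf n E i₀ →
      (missing n E P (i₀ + 1)).Nonempty ∧ nextV n E P (i₀ + 1) ≤ b ∧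
        z ∈ prevTails n E (nextV n E P (i₀ + 1)) ∧
        ∀ a ∈ prevTails n E (nextV n E P (i₀ + 1)), z ≤ a := by
    intro b hzb hrowb hbP hunit
    have hbn : b < n := H.bound hzb
    have hbrow : b ∈ rowSet n E (i₀ + 1) := (mem_rowSet_iff_row H hbn).2 hrowb
    have hmissb : (missing n E P (i₀ + 1)).Nonempty := ⟨b, (mem_missing).2 ⟨hbrow, hbP⟩⟩
    have hNle : nextV n E P (i₀ + 1) ≤ b :=
      (nextV_spec hmissb).2 b ((mem_missing).2 ⟨hbrow, hbP⟩)
    obtain ⟨hNm, -⟩ := nextV_spec hmissb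
    obtain ⟨hNrow, hNP⟩ := (mem_missing).1 hNm
    have hNn := lt_n_of_mem_rowSet H hNrow
    have hrowN : row n E (nextV n E P (i₀ + 1)) = i₀ + 1 := (mem_rowSet_iff_row H hNn).1 hNrow
    have hi₁n : i₀ + 1 ≤ n := by have := row_lt_n H hbn; omega
    have hnr := hP.not_ready_deeper H h (Nat.lt_succ_self _) hi₁n hunit hmissb
    obtain ⟨hne, ha₀P, ha₀⟩ := hP.par_of_not_ready H hmissb hnr
    obtain ⟨ha₀n, ha₀N, hrowa₀⟩ := (mem_prevTails).1 ha₀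
    have hrowa₀' : row n E (par n E (nextV n E P (i₀ + 1))) = i₀ := by omega
    have ha₀row : par n E (nextV n E P (i₀ + 1)) ∈ rowSet n E i₀ :=
      (mem_rowSet_iff_row H ha₀n).2 hrowa₀'
    have hza₀ : z ≤ par n E (nextV n E P (i₀ + 1)) := by
      by_contra hc
      exact ha₀P (hbelow _ ha₀row (lt_of_not_ge hc))
    have hzmem : z ∈ prevTails n E (nextV n E P (i₀ + 1)) := by
      rcases hza₀.lt_or_eq with hlt | heq
      · have hbN : b ≤ nextV n E P (i₀ + 1) := H.chain hzb ha₀N hlt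
        have hbN' : nextV n E P (i₀ + 1) = b := le_antisymm hNle hbN
        exact mem_prevTails_of H (hbN' ▸ hzb) (by rw [hrowz, hrowN])
      · rw [heq]; exact ha₀
    refine ⟨hmissb, hNle, hzmem, fun a ha => ?_⟩
    exact hza₀.trans ((par_of_nonempty hne).2 a ha)
  exact {
    sub := by
      intro v hv
      rcases Finset.mem_insert.1 hv with rfl | hv
      · exact hzn
      · exact hP.sub hv
    prefix_ := by
      intro u v hv huv hrow
      rcases Finset.mem_insert.1 hv with rfl | hv
      · have hun : u < n := lt_trans huv hzn
        exact hPP' (hbelow u ((mem_rowSet_iff_row H hun).2 (hrow.trans hrowz)) huv)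
      · exact hPP' (hP.prefix_ hv huv hrow)
    closed := by
      intro v hv
      rcases Finset.mem_insert.1 hv with rfl | hv
      · exact hready.mono hPP'
      · exact (hP.closed hv).mono hPP'
    seq := by
      intro u v hu hvn hlt
      rcases Finset.mem_insert.1 hu with rfl | hu
      · by_contra hvP'
        have hvP : v ∉ P := fun hc => hvP' (hPP' hc)
        have hne : ((Finset.range n) \ P).Nonempty :=
          ⟨v, Finset.mem_sdiff.2 ⟨Finset.mem_range.2 hvn, hvP⟩⟩
        obtain ⟨hmr, -⟩ := row_min_mem_readyRows H hne
        set m := ((Finset.range n) \ P).min' hne with hmdef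
        have hmv : m ≤ v := Finset.min'_le _ _ (Finset.mem_sdiff.2 ⟨Finset.mem_range.2 hvn, hvP⟩)
        have hmn : m < n := lt_of_le_of_lt hmv hvn
        have hrm : row n E m ≤ row n E v := row_mono H hmv hvn
        have hum := unitOf_mono (n := n) (E := E) hrm
        have hp := hmin _ hmr
        rw [prio_le_iff hi₀n (row_lt_n H hmn).le] at hp
        rw [hrowz] at hlt
        rcases hp with hp | ⟨hp, -⟩ <;> omega
      · exact hPP' (hP.seq hu hvn hlt)
    j1 := by
      intro u b hu hub hbP' hrowb hunit
      have hbP : b ∉ P := fun hc => hbP' (hPP' hc)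
      have hbn : b < n := H.bound hub
      have hmissb' : (missing n E (insert z P) (row n E u + 1)).Nonempty :=
        ⟨b, (mem_missing).2 ⟨(mem_rowSet_iff_row H hbn).2 hrowb, hbP'⟩⟩
      rcases Finset.mem_insert.1 hu with rfl | hu
      · rw [hrowz] at hrowb hunit hmissb' ⊢
        obtain ⟨hmissb, hNle, hzmem, hzmin⟩ := hkey hub hrowb hbP hunit
        refine ⟨nextV n E P (i₀ + 1), ?_, nextV_mono hmissb', hzmem, hzmin⟩
        obtain ⟨hNm, -⟩ := nextV_spec hmissb
        obtain ⟨hNrow, -⟩ := (mem_missing).1 hNm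
        exact (mem_rowSet_iff_row H (lt_n_of_mem_rowSet H hNrow)).1 hNrow
      · obtain ⟨v', hv'row, hv'le, huv', humin⟩ := hP.j1 hu hub hbP hrowb hunit
        exact ⟨v', hv'row, hv'le.trans (nextV_mono hmissb'), huv', humin⟩
    j2 := by
      intro a a' ha ha' haa' hrow hax ha'x hunit
      rcases Finset.mem_insert.1 ha with rfl | haP
      · -- `a = z`: then `a' > z` would be a processed vertex of row `i₀` above `z`
        rcases Finset.mem_insert.1 ha' with h' | ha'P
        · exact absurd (h' ▸ haa') (lt_irrefl _)
        · have ha'n : a' < n := hP.sub ha'P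
          have ha'row : a' ∈ rowSet n E i₀ := (mem_rowSet_iff_row H ha'n).2 (hrow.trans hrowz)
          have := (hP.mem_iff_lt_nextV H hmiss ha'row).1 ha'P
          exact absurd haa' (not_lt.2 this.le)
      rcases Finset.mem_insert.1 ha' with rfl | ha'P
      swap
      · exact hPP' (hP.j2 haP ha'P haa' hrow hax ha'x hunit)
      -- main case: `a ∈ P`, `a' = z`
      rw [hrowz] at hrow
      rw [← hrow] at hax ha'x hunit ⊢
      by_cases hxP : xr n E (i₀ + 2) ∈ P
      · exact hPP' hxP
      exfalso
      have hxn : xr n E (i₀ + 2) < n := H.bound hax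
      have hrowx : row n E (xr n E (i₀ + 2)) = i₀ + 2 := row_xr H hxn
      have hi₂n : i₀ + 2 ≤ n := by have := row_lt_n H hxn; omega
      have hxrow : xr n E (i₀ + 2) ∈ rowSet n E (i₀ + 2) := (mem_rowSet_iff_row H hxn).2 hrowx
      have hmiss₂ : (missing n E P (i₀ + 2)).Nonempty :=
        ⟨_, (mem_missing).2 ⟨hxrow, hxP⟩⟩
      have hnext₂ : nextV n E P (i₀ + 2) = xr n E (i₀ + 2) := by
        obtain ⟨hNm, hNmin⟩ := nextV_spec hmiss₂
        obtain ⟨hNrow, -⟩ := (mem_missing).1 hNm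
        exact le_antisymm (hNmin _ ((mem_missing).2 ⟨hxrow, hxP⟩)) ((mem_rowSet).1 hNrow).1
      have hnr₂ := hP.not_ready_deeper H h (by omega : i₀ < i₀ + 2) hi₂n hunit hmiss₂
      obtain ⟨hne₂, ha₁P, ha₁⟩ := hP.par_of_not_ready H hmiss₂ hnr₂
      rw [hnext₂] at hne₂ ha₁P ha₁
      obtain ⟨ha₁n, ha₁x, hrowa₁⟩ := (mem_prevTails).1 ha₁
      have hrowa₁' : row n E (par n E (xr n E (i₀ + 2))) = i₀ + 1 := by omega
      have ha₁row : par n E (xr n E (i₀ + 2)) ∈ rowSet n E (i₀ + 1) :=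
        (mem_rowSet_iff_row H ha₁n).2 hrowa₁'
      have hmiss₁ : (missing n E P (i₀ + 1)).Nonempty := ⟨_, (mem_missing).2 ⟨ha₁row, ha₁P⟩⟩
      have hunit₁ : unitOf n E (i₀ + 1) = unitOf n E i₀ := unitOf_add_one_eq_of_add_two hunit
      have hnr₁ := hP.not_ready_deeper H h (Nat.lt_succ_self _) (by omega) hunit₁ hmiss₁
      obtain ⟨hne₁, ha₀P, ha₀⟩ := hP.par_of_not_ready H hmiss₁ hnr₁
      obtain ⟨hNm, -⟩ := nextV_spec hmiss₁
      obtain ⟨hNrow, hNP⟩ := (mem_missing).1 hNm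
      have hNlt : nextV n E P (i₀ + 1) < xr n E (i₀ + 2) := ((mem_rowSet).1 hNrow).2
      obtain ⟨ha₀n, ha₀N, hrowa₀⟩ := (mem_prevTails).1 ha₀
      have hrowN : row n E (nextV n E P (i₀ + 1)) = i₀ + 1 :=
        (mem_rowSet_iff_row H (lt_n_of_mem_rowSet H hNrow)).1 hNrow
      have hrowa₀' : row n E (par n E (nextV n E P (i₀ + 1))) = i₀ := by omega
      have ha₀row : par n E (nextV n E P (i₀ + 1)) ∈ rowSet n E i₀ :=
        (mem_rowSet_iff_row H ha₀n).2 hrowa₀'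
      have hza₀ : z ≤ par n E (nextV n E P (i₀ + 1)) := by
        by_contra hc
        exact ha₀P (hbelow _ ha₀row (lt_of_not_ge hc))
      rcases hza₀.lt_or_eq with hlt | heq
      · have := H.chain ha'x ha₀N hlt
        omega
      · have hzN : E z (nextV n E P (i₀ + 1)) := heq ▸ ha₀N
        have := H.chain hax hzN haa'
        omega }

end Process

/-! ### E. Iterating the process; the key -/

section Iterates

variable {n : ℕ} {E : ℕ → ℕ → Prop} (H : IsChainRel n E)
include H

/-- Every iterate satisfies the invariant. [folklore] -/
private theorem inv_Pk : ∀ k, Inv n E (Pk n E k)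
  | 0 => Inv.empty
  | k + 1 => (inv_Pk k).step H

omit H in
/-- No vertex is processed at time `0`. [folklore] -/
private theorem Pk_zero : Pk n E 0 = ∅ := rfl

omit H in
/-- The iterates step. [folklore] -/
private theorem Pk_succ (k : ℕ) : Pk n E (k + 1) = step n E (Pk n E k) := rfl

omit H in
/-- The iterates increase. [folklore] -/
private theorem Pk_mono : Monotone (Pk n E) :=
  monotone_nat_of_le_succ fun k => subset_step (Pk n E k)

/-- Processed vertices are `< n`. [folklore] -/
private theorem Pk_sub (k : ℕ) : Pk n E k ⊆ Finset.range n := fun _ hv =>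
  Finset.mem_range.2 ((inv_Pk H k).sub hv)

/-- Exactly one vertex is processed per step until all `n` are: `|P_k| = min k n`. [folklore] -/
private theorem card_Pk (k : ℕ) : (Pk n E k).card = min k n := by
  induction k with
  | zero => simp [Pk_zero]
  | succ k ih =>
    rw [Pk_succ]
    by_cases hfull : ((Finset.range n) \ Pk n E k).Nonempty
    · have h := readyRows_nonempty H hfull
      rw [step_of_nonempty h, Finset.card_insert_of_notMem ((inv_Pk H k).step_data H h).2.2.2.1, ih]
      have hlt : (Pk n E k).card < n := by
        obtain ⟨w, hw⟩ := hfull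
        obtain ⟨hw1, hw2⟩ := Finset.mem_sdiff.1 hw
        have hss : Pk n E k ⊂ Finset.range n :=
          Finset.ssubset_iff_subset_ne.2 ⟨Pk_sub H k, fun heq => hw2 (heq ▸ hw1)⟩
        simpa using Finset.card_lt_card hss
      rw [ih] at hlt
      omega
    · have hsub : Finset.range n ⊆ Pk n E k := by
        intro w hw
        by_contra hc
        exact hfull ⟨w, Finset.mem_sdiff.2 ⟨hw, hc⟩⟩
      have heq : Pk n E k = Finset.range n := Finset.Subset.antisymm (Pk_sub H k) hsub
      have hempty : ¬ (readyRows n E (Pk n E k)).Nonempty := by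
        rintro ⟨i, hi⟩
        obtain ⟨-, ⟨v, hv⟩, -⟩ := (mem_readyRows).1 hi
        obtain ⟨hv1, hv2⟩ := (mem_missing).1 hv
        exact hv2 (hsub (Finset.mem_range.2 (lt_n_of_mem_rowSet H hv1)))
      rw [step_of_empty hempty, ih]
      have : (Pk n E k).card = n := by rw [heq]; simp
      rw [ih] at this
      omega

/-- After `n` steps every vertex is processed. [folklore] -/
private theorem Pk_n : Pk n E n = Finset.range n :=
  Finset.eq_of_subset_of_card_le (Pk_sub H n) (by simp [card_Pk H n])

/-- The key of a vertex is the step at which it is processed. [folklore] -/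
private theorem key_spec {v : ℕ} (hv : v < n) :
    v ∈ Pk n E (key n E v + 1) ∧ ∀ k, v ∈ Pk n E k → key n E v < k := by
  have hex : ∃ k, v ∈ Pk n E (k + 1) := by
    refine ⟨n - 1, ?_⟩
    rw [show n - 1 + 1 = n by omega, Pk_n H]
    exact Finset.mem_range.2 hv
  have hkey : key n E v = Nat.find hex := by simp [key, hex]
  refine ⟨hkey ▸ Nat.find_spec hex, fun k hk => ?_⟩
  rw [hkey]
  cases k with
  | zero => simp [Pk_zero] at hk
  | succ k =>
    have := Nat.find_le (h := hex) hk
    omega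

/-- A vertex is processed at time `k` iff its key is `< k`. [folklore] -/
private theorem mem_Pk_iff {v k : ℕ} (hv : v < n) : v ∈ Pk n E k ↔ key n E v < k := by
  refine ⟨(key_spec H hv).2 k, fun h => Pk_mono (show key n E v + 1 ≤ k from h) (key_spec H hv).1⟩

/-- Keys are `< n`. [folklore] -/
private theorem key_lt {v : ℕ} (hv : v < n) : key n E v < n :=
  (key_spec H hv).2 n (by rw [Pk_n H]; exact Finset.mem_range.2 hv)

/-- At most one vertex is processed per step. [folklore] -/
private theorem card_Pk_succ_sdiff (k : ℕ) : (Pk n E (k + 1) \ Pk n E k).card ≤ 1 := by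
  rw [Finset.card_sdiff_of_subset (Pk_mono (Nat.le_succ k)), card_Pk H, card_Pk H]
  omega

end Iterates

/-! ### F. Counting the incomplete vertices of a processed set -/

section Counting

variable {n : ℕ} {E : ℕ → ℕ → Prop} (H : IsChainRel n E)
include H

/-- Only the first vertex of a row has a tail two rows up: `|U2 i| ≤ 1`. [folklore] -/
private theorem card_U2_le_one (P : Finset ℕ) (i : ℕ) : (U2 n E P i).card ≤ 1 := by
  refine Finset.card_le_one.2 fun u hu u' hu' => ?_
  have key : ∀ w ∈ U2 n E P i, w = xr n E i := by
    intro w hw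
    obtain ⟨-, hrow, a, haw, hra, -⟩ := Finset.mem_filter.1 hw
    rcases row_head H haw with h | ⟨h, -⟩
    · omega
    · rw [h, hra]
  rw [key u hu, key u' hu']

/-- At most one processed vertex per row has an unprocessed tail in the previous row (prefix + closedness + chain): `|U1 i| ≤ 1`. [folklore] -/
private theorem card_U1_le_one {P : Finset ℕ} (hP : Inv n E P) (i : ℕ) : (U1 n E P i).card ≤ 1 := by
  refine Finset.card_le_one.2 fun u hu u' hu' => ?_
  have main : ∀ u ∈ U1 n E P i, ∀ u' ∈ U1 n E P i, ¬ u < u' := by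
    intro u hu u' hu' hlt
    obtain ⟨-, hrow, a, hau, hra, haP⟩ := Finset.mem_filter.1 hu
    obtain ⟨hu'P, hrow', a'', ha''u', hra'', -⟩ := Finset.mem_filter.1 hu'
    have hne : (prevTails n E u').Nonempty := ⟨a'', mem_prevTails_of H ha''u' (by omega)⟩
    obtain ⟨hpar, -⟩ := par_of_nonempty hne
    obtain ⟨hparn, hparu', hrpar⟩ := (mem_prevTails).1 hpar
    have hparP : par n E u' ∈ P := by
      rcases hP.closed hu'P with h0 | h
      · omega
      · exact h
    have hle : a ≤ par n E u' := H.tail_le hau hparu' hlt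
    rcases hle.lt_or_eq with hlt' | heq
    · exact haP (hP.prefix_ hparP hlt' (by omega))
    · exact haP (heq ▸ hparP)
  rcases lt_trichotomy u u' with h | h | h
  · exact absurd h (main u hu u' hu')
  · exact h
  · exact absurd h (main u' hu' u hu)

/-- Inside a unit at most one processed vertex per row has an unprocessed head in the next row (invariant `j1` + chain): `|D1 i| ≤ 1`. [folklore] -/
private theorem card_D1_le_one {P : Finset ℕ} (hP : Inv n E P) {i : ℕ}
    (hunit : unitOf n E (i + 1) = unitOf n E i) : (D1 n E P i).card ≤ 1 := by
  refine Finset.card_le_one.2 fun u hu u' hu' => ?_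
  have main : ∀ u ∈ D1 n E P i, ∀ u' ∈ D1 n E P i, ¬ u < u' := by
    intro u hu u' hu' hlt
    obtain ⟨huP, hrow, b, hub, hrb, hbP⟩ := Finset.mem_filter.1 hu
    obtain ⟨hu'P, hrow', b', hu'b', hrb', hb'P⟩ := Finset.mem_filter.1 hu'
    obtain ⟨v₁, hrv₁, hv₁le, huv₁, humin⟩ :=
      hP.j1 huP hub hbP (by rw [hrb, hrow]) (by rw [hrow]; exact hunit)
    obtain ⟨v₂, hrv₂, hv₂le, hu'v₂, hu'min⟩ :=
      hP.j1 hu'P hu'b' hb'P (by rw [hrb', hrow']) (by rw [hrow']; exact hunit)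
    rw [hrow] at hrv₁ hv₁le
    rw [hrow'] at hrv₂ hv₂le
    have hbn : b < n := H.bound hub
    have hmiss : (missing n E P (i + 1)).Nonempty :=
      ⟨b, (mem_missing).2 ⟨(mem_rowSet_iff_row H hbn).2 hrb, hbP⟩⟩
    have hNb : nextV n E P (i + 1) ≤ b :=
      (nextV_spec hmiss).2 b ((mem_missing).2 ⟨(mem_rowSet_iff_row H hbn).2 hrb, hbP⟩)
    rcases lt_trichotomy v₁ v₂ with h12 | h12 | h12
    · -- `v₁ < v₂ ≤ b`: the chain forces `b = v₂`, and then `u` is a tail of `v₂` below `u'`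
      have hv₂b : v₂ ≤ b := hv₂le.trans hNb
      have hbv₂ : b ≤ v₂ := H.chain hub ((mem_prevTails).1 hu'v₂).2.1 hlt
      have heq : v₂ = b := le_antisymm hv₂b hbv₂
      have humem : u ∈ prevTails n E v₂ := mem_prevTails_of H (heq ▸ hub) (by rw [hrow, hrv₂])
      exact absurd (hu'min u humem) (not_le.2 hlt)
    · subst h12
      exact absurd (le_antisymm (humin u' hu'v₂) (hu'min u huv₁)) (ne_of_lt hlt)
    · exact absurd (prevTails_mono H h12 hu'v₂ huv₁) (not_le.2 hlt)
  rcases lt_trichotomy u u' with h | h | h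
  · exact absurd h (main u hu u' hu')
  · exact h
  · exact absurd h (main u' hu' u hu)

omit H in
/-- Inside a unit at most one processed vertex per row is a tail of the unprocessed exceptional head (invariant `j2`): `|D2 i| ≤ 1`. [folklore] -/
private theorem card_D2_le_one {P : Finset ℕ} (hP : Inv n E P) {i : ℕ}
    (hunit : unitOf n E (i + 2) = unitOf n E i) : (D2 n E P i).card ≤ 1 := by
  refine Finset.card_le_one.2 fun u hu u' hu' => ?_
  have main : ∀ u ∈ D2 n E P i, ∀ u' ∈ D2 n E P i, ¬ u < u' := by
    intro u hu u' hu' hlt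
    obtain ⟨huP, hrow, hux, hxP⟩ := Finset.mem_filter.1 hu
    obtain ⟨hu'P, hrow', hu'x, -⟩ := Finset.mem_filter.1 hu'
    rw [← hrow] at hux hu'x hxP hunit
    exact hxP (hP.j2 huP hu'P hlt (hrow'.trans hrow.symm) hux hu'x hunit)
  rcases lt_trichotomy u u' with h | h | h
  · exact absurd h (main u hu u' hu')
  · exact h
  · exact absurd h (main u' hu' u hu)

omit H in
/-- The processed part of a row is at most the row. [folklore] -/
private theorem card_PR_le {P : Finset ℕ} (hsub : ∀ ⦃v : ℕ⦄, v ∈ P → v < n) (HH : IsChainRel n E)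
    (i : ℕ) : (PR n E P i).card ≤ xr n E (i + 1) - xr n E i := by
  rw [← card_rowSet (n := n) (E := E) i]
  refine Finset.card_le_card fun u hu => ?_
  obtain ⟨huP, hrow⟩ := Finset.mem_filter.1 hu
  exact (mem_rowSet_iff_row HH (hsub huP)).2 hrow

omit H in
/-- A finite set of naturals any two of whose elements differ by at most one has at most two elements. [folklore] -/
private theorem card_le_two_of_close {S : Finset ℕ} (h : ∀ i ∈ S, ∀ i' ∈ S, i < i' → i' ≤ i + 1) :
    S.card ≤ 2 := by
  rcases S.eq_empty_or_nonempty with rfl | hne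
  · simp
  · have hsub : S ⊆ {S.min' hne, S.min' hne + 1} := by
      intro i hi
      have hle := Finset.min'_le S i hi
      rcases hle.lt_or_eq with hlt | heq
      · have := h _ (Finset.min'_mem S hne) i hi hlt
        have : i = S.min' hne + 1 := by omega
        simp [this]
      · simp [← heq]
    exact (Finset.card_le_card hsub).trans (Finset.card_le_two)

omit H in
/-- Telescoping: the widths of the rows below row `m` sum to `xr m`. [folklore] -/
private theorem sum_width (HH : IsChainRel n E) (m : ℕ) :
    ((Finset.range m).sum fun i => xr n E (i + 1) - xr n E i) = xr n E m := by
  induction m with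
  | zero => simp [xr_zero]
  | succ m ih =>
    rw [Finset.sum_range_succ, ih]
    have := xr_le_succ HH m
    omega

/-- There are fewer than `s` wide rows (the widths sum to `n < s²`). [folklore] -/
private theorem card_wide_lt : ((Finset.range n).filter fun i => Wide n E i).card < sPar n := by
  set W := (Finset.range n).filter fun i => Wide n E i with hW
  have h1 : W.card * (sPar n + 1) ≤ n := by
    calc W.card * (sPar n + 1) = W.sum (fun _ => sPar n + 1) := by simp
      _ ≤ W.sum (fun i => xr n E (i + 1) - xr n E i) := by
        refine Finset.sum_le_sum fun i hi => ?_
        have := (Finset.mem_filter.1 hi).2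
        unfold Wide at this
        omega
      _ ≤ (Finset.range n).sum (fun i => xr n E (i + 1) - xr n E i) :=
        Finset.sum_le_sum_of_subset (Finset.filter_subset _ _)
      _ = n := by rw [sum_width H n, xr_n H]
  have h2 : n < sPar n * sPar n := Nat.lt_succ_sqrt n
  by_contra hc
  have hc' : sPar n ≤ W.card := not_lt.1 hc
  have : sPar n * (sPar n + 1) ≤ W.card * (sPar n + 1) := Nat.mul_le_mul_right _ hc'
  nlinarith

omit H in
/-- A unit has at most `2 W + 1` rows, `W` the number of wide rows: every row of a unit but the last is wide or follows a wide row. [folklore] -/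
private theorem card_unit_rows_le (j : ℕ) :
    ((Finset.range n).filter fun i => unitOf n E i = j).card ≤
      2 * ((Finset.range n).filter fun i => Wide n E i).card + 1 := by
  set S := (Finset.range n).filter fun i => unitOf n E i = j with hS
  set Wd := (Finset.range n).filter fun i => Wide n E i with hWd
  rcases S.eq_empty_or_nonempty with hSe | hne
  · rw [hSe]; simp
  set K := S.max' hne with hK
  have hKmem : K ∈ S := Finset.max'_mem S hne
  set S' := S.erase K with hS'
  have hcard : S.card = S'.card + 1 := by
    rw [hS', Finset.card_erase_of_mem hKmem]
    have := Finset.card_pos.2 hne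
    omega
  -- every row of the unit other than the last is not a unit end, hence wide or after a wide row
  have hwide : ∀ i ∈ S', Wide n E i ∨ (i ≠ 0 ∧ Wide n E (i - 1)) := by
    intro i hi
    obtain ⟨hiK, hiS⟩ := Finset.mem_erase.1 hi
    have hile : i ≤ K := Finset.le_max' S i hiS
    have hilt : i < K := lt_of_le_of_ne hile hiK
    have hui : unitOf n E i = j := (Finset.mem_filter.1 hiS).2
    have huK : unitOf n E K = j := (Finset.mem_filter.1 hKmem).2
    have h1 := unitOf_mono (n := n) (E := E) (show i ≤ i + 1 by omega)
    have h2 := unitOf_mono (n := n) (E := E) (show i + 1 ≤ K by omega)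
    have hnot : ¬ IsEnd n E i := by
      rw [← unitOf_succ_eq_iff]; omega
    unfold IsEnd at hnot
    by_cases hw : Wide n E i
    · exact Or.inl hw
    · right
      by_contra hc
      apply hnot
      refine ⟨hw, ?_⟩
      by_cases hi0 : i = 0
      · exact Or.inl hi0
      · exact Or.inr fun hw1 => hc ⟨hi0, hw1⟩
  let f : ℕ → ℕ := fun i => if Wide n E i then i else i - 1
  have hmaps : ∀ i ∈ S', f i ∈ Wd := by
    intro i hi
    have hin : i < n := Finset.mem_range.1 (Finset.mem_filter.1 (Finset.mem_erase.1 hi).2).1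
    rcases hwide i hi with hw | ⟨hi0, hw⟩
    · simp only [f, if_pos hw]
      exact Finset.mem_filter.2 ⟨Finset.mem_range.2 hin, hw⟩
    · by_cases hw' : Wide n E i
      · simp only [f, if_pos hw']
        exact Finset.mem_filter.2 ⟨Finset.mem_range.2 hin, hw'⟩
      · simp only [f, if_neg hw']
        exact Finset.mem_filter.2 ⟨Finset.mem_range.2 (by omega), hw⟩
  have hfib : ∀ w ∈ S'.image f, (S'.filter fun i => f i = w).card ≤ 2 := by
    intro w _
    refine (Finset.card_le_card (t := {w, w + 1}) fun i hi => ?_).trans Finset.card_le_two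
    have hfi := (Finset.mem_filter.1 hi).2
    simp only [f] at hfi
    split_ifs at hfi <;> simp <;> omega
  have h1 : S'.card ≤ 2 * (S'.image f).card := Finset.card_le_mul_card_image S' 2 hfib
  have h2 : (S'.image f).card ≤ Wd.card := Finset.card_le_card fun w hw => by
    obtain ⟨i, hi, rfl⟩ := Finset.mem_image.1 hw
    exact hmaps i hi
  omega

end Counting

/-! ### G. The cover of the incomplete set and the width bound -/

section Cover

variable {n : ℕ} {E : ℕ → ℕ → Prop} (H : IsChainRel n E)
include H

omit H in
/-- `4 ≤ 12 s`. [folklore] -/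
private theorem four_le_twelve_sPar : 4 ≤ 12 * sPar n := by unfold sPar; omega

/-- **The width bound.** A processed set satisfying the invariant has at most `12 s - 4` vertices with an unprocessed neighbour: those lie in the (narrow) rows `i` with `unitOf i < j ≤ unitOf (i+2)` or `unitOf i = j < unitOf (i+2)` (`j` the current unit; at most two rows each, `≤ s` vertices each), or are among the `≤ 4` internal incomplete vertices (`U1`, `U2`, `D1`, `D2`) of a row of unit `j` (`< 2s` rows). [folklore] -/
private theorem card_incomplete_le {P : Finset ℕ} (hP : Inv n E P) :
    (incomplete n E P).card + 4 ≤ 12 * sPar n := by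
  by_cases hne : ((Finset.range n) \ P).Nonempty
  swap
  · have : incomplete n E P = ∅ := by
      refine Finset.eq_empty_of_forall_notMem fun u hu => ?_
      obtain ⟨-, w, hwn, hwP, -⟩ := Finset.mem_filter.1 hu
      exact hne ⟨w, Finset.mem_sdiff.2 ⟨Finset.mem_range.2 hwn, hwP⟩⟩
    rw [this, Finset.card_empty, zero_add]
    exact four_le_twelve_sPar
  set m := ((Finset.range n) \ P).min' hne with hmdef
  have hmmem : m ∈ (Finset.range n) \ P := Finset.min'_mem _ _
  have hmn : m < n := Finset.mem_range.1 (Finset.mem_sdiff.1 hmmem).1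
  have hmP : m ∉ P := (Finset.mem_sdiff.1 hmmem).2
  set j := unitOf n E (row n E m) with hjdef
  have F1 : ∀ w, w < n → w ∉ P → j ≤ unitOf n E (row n E w) := by
    intro w hwn hwP
    have hmw : m ≤ w := Finset.min'_le _ _ (Finset.mem_sdiff.2 ⟨Finset.mem_range.2 hwn, hwP⟩)
    exact unitOf_mono (row_mono H hmw hwn)
  have F2 : ∀ u ∈ P, unitOf n E (row n E u) ≤ j := by
    intro u hu
    by_contra hc
    exact hmP (hP.seq hu hmn (lt_of_not_ge hc))
  -- the cover
  set fA := (Finset.range n).filter fun i => unitOf n E i < j ∧ j ≤ unitOf n E (i + 2) with hfA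
  set fB := (Finset.range n).filter fun i => unitOf n E i = j ∧ j < unitOf n E (i + 2) with hfB
  set fC := (Finset.range n).filter fun i => unitOf n E i = j with hfC
  set g : ℕ → Finset ℕ := fun i => U1 n E P i ∪ U2 n E P i ∪
    (if unitOf n E (i + 2) = j then D1 n E P i ∪ D2 n E P i else ∅) with hg
  have hcover : incomplete n E P ⊆ fA.biUnion (PR n E P) ∪ fB.biUnion (PR n E P) ∪ fC.biUnion g := by
    intro u hu
    obtain ⟨huP, w, hwn, hwP, hE⟩ := Finset.mem_filter.1 hu
    have hun : u < n := hP.sub huP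
    have hrun : row n E u < n := row_lt_n H hun
    have huj := F2 u huP
    have hwj := F1 w hwn hwP
    have huPR : u ∈ PR n E P (row n E u) := Finset.mem_filter.2 ⟨huP, rfl⟩
    rcases hE with huw | hwu
    · -- `w` is an unprocessed head of `u`
      have hrw := row_head H huw
      have hwle : row n E w ≤ row n E u + 2 := row_head_le H huw
      have hj2 : j ≤ unitOf n E (row n E u + 2) := hwj.trans (unitOf_mono hwle)
      rcases huj.lt_or_eq with hlt | heq
      · refine Finset.mem_union_left _ (Finset.mem_union_left _ ?_)
        exact Finset.mem_biUnion.2 ⟨row n E u,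
          Finset.mem_filter.2 ⟨Finset.mem_range.2 hrun, hlt, hj2⟩, huPR⟩
      · rcases hj2.lt_or_eq with hlt2 | heq2
        · refine Finset.mem_union_left _ (Finset.mem_union_right _ ?_)
          exact Finset.mem_biUnion.2 ⟨row n E u,
            Finset.mem_filter.2 ⟨Finset.mem_range.2 hrun, heq, hlt2⟩, huPR⟩
        · refine Finset.mem_union_right _ (Finset.mem_biUnion.2 ⟨row n E u,
            Finset.mem_filter.2 ⟨Finset.mem_range.2 hrun, heq⟩, ?_⟩)
          simp only [hg]
          rw [if_pos heq2.symm]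
          refine Finset.mem_union_right _ ?_
          rcases hrw with h1 | ⟨h2, -⟩
          · exact Finset.mem_union_left _
              (Finset.mem_filter.2 ⟨huP, rfl, w, huw, h1, hwP⟩)
          · exact Finset.mem_union_right _
              (Finset.mem_filter.2 ⟨huP, rfl, h2 ▸ huw, h2 ▸ hwP⟩)
    · -- `w` is an unprocessed tail of `u`
      have hrw := row_head H hwu
      have hle1 : row n E w + 1 ≤ row n E u := row_head_ge H hwu
      have hwu_j : unitOf n E (row n E w) ≤ unitOf n E (row n E u) := unitOf_mono (by omega)
      have heq : unitOf n E (row n E u) = j := le_antisymm huj (hwj.trans hwu_j)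
      refine Finset.mem_union_right _ (Finset.mem_biUnion.2 ⟨row n E u,
        Finset.mem_filter.2 ⟨Finset.mem_range.2 hrun, heq⟩, ?_⟩)
      simp only [hg]
      refine Finset.mem_union_left _ ?_
      rcases hrw with h1 | ⟨-, h2⟩
      · exact Finset.mem_union_left _ (Finset.mem_filter.2 ⟨huP, rfl, w, hwu, h1.symm, hwP⟩)
      · exact Finset.mem_union_right _ (Finset.mem_filter.2 ⟨huP, rfl, w, hwu, h2.symm, hwP⟩)
  -- cardinalities
  have hPRle : ∀ i, unitOf n E (i + 2) ≠ unitOf n E i → (PR n E P i).card ≤ sPar n := by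
    intro i hi
    have h1 := card_PR_le hP.sub H (P := P) i
    have h2 := not_wide_of_unitOf_ne hi
    unfold Wide at h2
    omega
  have hA : (fA.biUnion (PR n E P)).card ≤ 2 * sPar n := by
    have h1 : fA.card ≤ 2 := by
      refine card_le_two_of_close fun i hi i' hi' hlt => ?_
      by_contra hc
      have hii : i + 2 ≤ i' := by omega
      have h1 := (Finset.mem_filter.1 hi).2
      have h2 := (Finset.mem_filter.1 hi').2
      have := unitOf_mono (n := n) (E := E) hii
      omega
    calc (fA.biUnion (PR n E P)).card ≤ fA.sum (fun i => (PR n E P i).card) :=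
        Finset.card_biUnion_le
      _ ≤ fA.sum (fun _ => sPar n) := Finset.sum_le_sum fun i hi => by
        have h := (Finset.mem_filter.1 hi).2
        exact hPRle i (by omega)
      _ = fA.card * sPar n := by simp
      _ ≤ 2 * sPar n := Nat.mul_le_mul_right _ h1
  have hB : (fB.biUnion (PR n E P)).card ≤ 2 * sPar n := by
    have h1 : fB.card ≤ 2 := by
      refine card_le_two_of_close fun i hi i' hi' hlt => ?_
      by_contra hc
      have hii : i + 2 ≤ i' := by omega
      have h1 := (Finset.mem_filter.1 hi).2
      have h2 := (Finset.mem_filter.1 hi').2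
      have := unitOf_mono (n := n) (E := E) hii
      omega
    calc (fB.biUnion (PR n E P)).card ≤ fB.sum (fun i => (PR n E P i).card) :=
        Finset.card_biUnion_le
      _ ≤ fB.sum (fun _ => sPar n) := Finset.sum_le_sum fun i hi => by
        have h := (Finset.mem_filter.1 hi).2
        exact hPRle i (by omega)
      _ = fB.card * sPar n := by simp
      _ ≤ 2 * sPar n := Nat.mul_le_mul_right _ h1
  have hg4 : ∀ i ∈ fC, (g i).card ≤ 4 := by
    intro i hi
    have hij : unitOf n E i = j := (Finset.mem_filter.1 hi).2
    simp only [hg]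
    have h1 := card_U1_le_one H hP i
    have h2 := card_U2_le_one H P i
    refine (Finset.card_union_le _ _).trans ?_
    have h12 : (U1 n E P i ∪ U2 n E P i).card ≤ 2 := (Finset.card_union_le _ _).trans (by omega)
    split_ifs with hu
    · have hu' : unitOf n E (i + 2) = unitOf n E i := hu.trans hij.symm
      have h3 := card_D1_le_one H hP (unitOf_add_one_eq_of_add_two hu')
      have h4 := card_D2_le_one hP hu'
      have h34 : (D1 n E P i ∪ D2 n E P i).card ≤ 2 := (Finset.card_union_le _ _).trans (by omega)
      omega
    · simp; omega
  have hC : (fC.biUnion g).card + 4 ≤ 8 * sPar n := by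
    have h1 : fC.card ≤ 2 * ((Finset.range n).filter fun i => Wide n E i).card + 1 :=
      card_unit_rows_le j
    have h2 := card_wide_lt H
    have h3 : (fC.biUnion g).card ≤ fC.card * 4 :=
      calc (fC.biUnion g).card ≤ fC.sum (fun i => (g i).card) := Finset.card_biUnion_le
        _ ≤ fC.sum (fun _ => 4) := Finset.sum_le_sum fun i hi => hg4 i hi
        _ = fC.card * 4 := by simp
    have h4 : fC.card + 1 ≤ 2 * sPar n := by omega
    omega
  have := Finset.card_le_card hcover
  have hu1 := Finset.card_union_le (fA.biUnion (PR n E P) ∪ fB.biUnion (PR n E P)) (fC.biUnion g)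
  have hu2 := Finset.card_union_le (fA.biUnion (PR n E P)) (fB.biUnion (PR n E P))
  omega

end Cover

/-! ### H. Graphs on `Fin n` whose edge set is a chain -/

section Graph

/-- The ordered edge relation of a graph with pairwise comparable edges is a chain relation. [folklore] -/
private theorem isChainRel_relOf {n : ℕ} (G : _root_.SimpleGraph (Fin n))
    (hG : ∀ ⦃u v u' v' : Fin n⦄, G.Adj u v → G.Adj u' v' → u < v → u' < v' → u < u' → v ≤ v') :
    IsChainRel n (relOf G) where
  lt := fun ⟨h, _⟩ => h.1
  bound := fun ⟨h, _⟩ => h.2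
  chain := by
    rintro a b a' b' ⟨h, hadj⟩ ⟨h', hadj'⟩ hlt
    have := hG hadj hadj' (Fin.mk_lt_mk.2 h.1) (Fin.mk_lt_mk.2 h'.1) (Fin.mk_lt_mk.2 hlt)
    exact Fin.mk_le_mk.1 this

/-- An edge is an ordered edge one way or the other. [folklore] -/
private theorem relOf_of_adj {n : ℕ} {G : _root_.SimpleGraph (Fin n)} {u v : Fin n} (h : G.Adj u v) :
    relOf G u v ∨ relOf G v u := by
  rcases lt_or_gt_of_ne (G.ne_of_adj h) with hlt | hgt
  · exact Or.inl ⟨⟨hlt, v.isLt⟩, h⟩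
  · exact Or.inr ⟨⟨hgt, u.isLt⟩, h.symm⟩

/-- **Treewidth of chain graphs** — the combinatorial core of BDI Prop 7.5 (1). A graph on `Fin n`
whose edges, read as pairs (smaller end, larger end), are pairwise comparable in the product
order of `ℕ²` has treewidth at most `12 (⌊√n⌋ + 1) - 4`: the key `key n (relOf G)` of the process
gives bags of size `≤ 12 (⌊√n⌋ + 1) - 3` (`card_incomplete_le`). Our proof; the printed route via
planarity and the excluded-grid theorem is not followed (see the module docstring).
[cite: BlaserDorflerIkenmeyer2020, Prop 20 (1) (arXiv; = CCC 2021 Prop 7.5 (1)), the graph-theoretic core] -/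
theorem treewidth_le_of_chain {n : ℕ} (G : _root_.SimpleGraph (Fin n))
    (hG : ∀ ⦃u v u' v' : Fin n⦄, G.Adj u v → G.Adj u' v' → u < v → u' < v' → u < u' → v ≤ v') :
    treewidth G ≤ 12 * (Nat.sqrt n + 1) - 4 := by
  rcases Nat.eq_zero_or_pos n with hn | hn
  · subst hn
    exact (treewidth_le_card_sub_one G).trans (by simp)
  have H := isChainRel_relOf G hG
  set E := relOf G with hE
  refine treewidth_le_of_key G (fun v => key n E v) (n - 1) _ (fun v => by
    have := key_lt H v.isLt; omega) fun t ht => ?_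
  -- the bag at `t` injects into `(P_{t+1} \ P_t) ∪ incomplete P_t`
  have hinj : (keyBag G (fun v => key n E v) t).card ≤
      ((Pk n E (t + 1) \ Pk n E t) ∪ incomplete n E (Pk n E t)).card := by
    refine Finset.card_le_card_of_injOn (fun v : Fin n => (v : ℕ)) (fun v hv => ?_)
      (fun v _ v' _ h => Fin.ext h)
    rcases mem_keyBag.1 (Finset.mem_coe.1 hv) with h | ⟨hlt, u, hu, htu⟩
    · refine Finset.mem_coe.2 (Finset.mem_union_left _ (Finset.mem_sdiff.2 ⟨?_, ?_⟩))
      · exact (mem_Pk_iff H v.isLt).2 (by omega)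
      · rw [mem_Pk_iff H v.isLt]; omega
    · refine Finset.mem_coe.2 (Finset.mem_union_right _ (Finset.mem_filter.2 ⟨?_, u, u.isLt, ?_, ?_⟩))
      · exact (mem_Pk_iff H v.isLt).2 hlt
      · rw [mem_Pk_iff H u.isLt]; omega
      · exact relOf_of_adj hu
  have h1 := card_Pk_succ_sdiff H t
  have h2 := card_incomplete_le H (inv_Pk H t)
  have h3 := Finset.card_union_le (Pk n E (t + 1) \ Pk n E t) (incomplete n E (Pk n E t))
  unfold sPar at h2
  omega

end Graph

end BDI20Treewidth

/-! ### I. Two-row semistandard tableaux: the edge set of `G_S` is a chain -/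

section Tableau

open BDI2020 BDI20Treewidth Literature.Combinatorics.SimpleGraph

/-- A strictly increasing column of height `≤ 2` containing `i < j` is the column `[i, j]`. [folklore] -/
private theorem BDI20Treewidth.col_eq_pair {c : List ℕ} (hlen : c.length ≤ 2) (hchain : c.IsChain (· < ·))
    {i j : ℕ} (hi : i ∈ c) (hj : j ∈ c) (hij : i < j) : c = [i, j] := by
  match c, hlen, hchain, hi, hj with
  | [], _, _, hi, _ => simp at hi
  | [a], _, _, hi, hj =>
    simp only [List.mem_singleton] at hi hj
    omega
  | [a, b], _, hchain, hi, hj =>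
    have hab : a < b := List.isChain_pair.1 hchain
    simp only [List.mem_cons, List.not_mem_nil, or_false] at hi hj
    rcases hi with rfl | rfl <;> rcases hj with rfl | rfl
    · omega
    · rfl
    · omega
    · omega
  | a :: b :: d :: t, hlen, _, _, _ => simp at hlen

/-- Consecutive-column comparisons of a semistandard tableau of partition shape propagate to all pairs of columns (entrywise `≤` on the rows of the later, shorter-or-equal column). [folklore] -/
private theorem BDI20Treewidth.pairwise_cols :
    ∀ S : List (List ℕ), S.IsChain (fun c c' => ∀ i, i < c'.length → c.getD i 0 ≤ c'.getD i 0) →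
      S.Pairwise (fun c c' => c'.length ≤ c.length) →
      S.Pairwise (fun c c' => ∀ i, i < c'.length → c.getD i 0 ≤ c'.getD i 0)
  | [], _, _ => List.Pairwise.nil
  | [c], _, _ => List.pairwise_singleton _ _
  | c :: d :: t, hch, hlen => by
    obtain ⟨hcd, hch'⟩ := List.isChain_cons_cons.1 hch
    have hlen' := (List.pairwise_cons.1 hlen).2
    have ih := BDI20Treewidth.pairwise_cols (d :: t) hch' hlen'
    refine List.pairwise_cons.2 ⟨fun x hx => ?_, ih⟩
    rcases List.mem_cons.1 hx with rfl | hx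
    · exact hcd
    · have hdx := List.rel_of_pairwise_cons ih hx
      have hxl : x.length ≤ d.length := List.rel_of_pairwise_cons hlen' hx
      intro i hi
      exact (hcd i (lt_of_lt_of_le hi hxl)).trans (hdx i hi)

/-- Two members of a pairwise-related list are equal or related one way or the other. [folklore] -/
private theorem BDI20Treewidth.pairwise_mem {α : Type*} {R : α → α → Prop} :
    ∀ {l : List α}, l.Pairwise R → ∀ {a b : α}, a ∈ l → b ∈ l → a = b ∨ R a b ∨ R b a
  | [], _, a, b, ha, _ => by simp at ha
  | x :: t, h, a, b, ha, hb => by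
    rw [List.pairwise_cons] at h
    rcases List.mem_cons.1 ha with rfl | ha' <;> rcases List.mem_cons.1 hb with rfl | hb'
    · exact Or.inl rfl
    · exact Or.inr (Or.inl (h.1 _ hb'))
    · exact Or.inr (Or.inr (h.1 _ ha'))
    · exact BDI20Treewidth.pairwise_mem h.2 ha' hb'

/-- The edge set of the graph of a two-row semistandard Young tableau is a chain: of two edges,
the one with the larger smaller end has the larger-or-equal larger end ("Due to `T` being
semistandard this implies `i ≤ k` and `j ≤ l`, which means those two edges do not cross").
[cite: BlaserDorflerIkenmeyer2020, Prop 19 (proof; arXiv p0016.txt:L7-8; = CCC 2021 Prop 7.4)] -/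
theorem BDI20Treewidth.tableauGraph_chain {n : ℕ} {S : List (List ℕ)}
    (hshape : S.Pairwise (fun c c' => c'.length ≤ c.length)) (hss : IsSemistandard S)
    (h2 : ∀ c ∈ S, c.length ≤ 2) :
    ∀ ⦃u v u' v' : Fin n⦄, (tableauGraph S n).Adj u v → (tableauGraph S n).Adj u' v' →
      u < v → u' < v' → u < u' → v ≤ v' := by
  intro u v u' v' huv hu'v' hlt hlt' huu'
  have hpw := BDI20Treewidth.pairwise_cols S hss.2 hshape
  -- the columns of the two edges
  have hcol : ∀ {a b : Fin n}, (tableauGraph S n).Adj a b → a < b → [a.val, b.val] ∈ S := by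
    intro a b hab hablt
    rw [tableauGraph, SimpleGraph.fromRel_adj] at hab
    obtain ⟨-, h⟩ := hab
    have : ∃ c ∈ S, a.val ∈ c ∧ b.val ∈ c := by
      rcases h with ⟨c, hc, ha, hb⟩ | ⟨c, hc, hb, ha⟩ <;> exact ⟨c, hc, ha, hb⟩
    obtain ⟨c, hc, ha, hb⟩ := this
    have := BDI20Treewidth.col_eq_pair (h2 c hc) (hss.1 c hc) ha hb (Fin.lt_def.1 hablt)
    exact this ▸ hc
  have hc := hcol huv hlt
  have hc' := hcol hu'v' hlt'
  rcases BDI20Treewidth.pairwise_mem hpw hc hc' with heq | h | h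
  · have : (u : ℕ) = u' := by
      have := congrArg List.head? heq
      simpa using this
    exact absurd huu' (by rw [Fin.lt_def, this]; exact lt_irrefl _)
  · have := h 1 (by simp)
    simpa using this
  · have := h 0 (by simp)
    simp at this
    exact absurd huu' (not_lt.2 (Fin.le_def.2 this))

/-- **BDI Prop 7.5 (1) holds** (CCC 2021 Prop 7.5 (1) = arXiv Prop 20 (1)), with the explicit
constant `C = 12`: the graph of a two-row semistandard Young tableau with entries `< n` has
treewidth at most `12 (⌊√n⌋ + 1)`. The printed proof ("`G_S` is planar by Prop 7.4, and planar
graphs on `n` vertices have treewidth `O(√n)` by the planar excluded grid theorem [RST94]") is NOT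
followed — neither planarity nor the excluded-grid / planar-separator theorem is in the tree;
instead the edge set of `G_S` is a chain in `ℕ²` (`tableauGraph_chain`) and such graphs get an
explicit path decomposition of width `< 12 (⌊√n⌋ + 1)` (`BDI20Treewidth.treewidth_le_of_chain`:
rows by first-head layering; the wide rows of a unit processed deepest-ready-first in the manner
of the "leveled planar ⇒ layered pathwidth one" greedy sweep, narrow rows in their natural order).
[cite: BlaserDorflerIkenmeyer2020, Prop 20 (1) (arXiv; = CCC 2021 Prop 7.5 (1))] -/
theorem BDI2020_prop_7_5_upper_holds : BDI2020_prop_7_5_upper := by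
  refine ⟨12, fun n S _ hshape hss h2 _ => ?_⟩
  exact (BDI20Treewidth.treewidth_le_of_chain (tableauGraph S n)
    (BDI20Treewidth.tableauGraph_chain hshape hss h2)).trans (Nat.sub_le _ _)

end Tableau

end Literature.Computability.AlgebraicComplexity

end
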